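import Summits.MatrixMultiplication.OmegaCensus.SmallFormats.MatMul22nF3LineLemmas
import HarnessLib

/-!
# ω-census family (a): FACTORED entries of the INV-layer matrix `Q` are `±` an explicit point pairing (`𝔽₃`)

Cell `pub-omega` (unit `pub-omega-tensor`, gen 40), topic `Summits/MatrixMultiplication/OmegaCensus` (sub-folder
`SmallFormats`). Framing (verbatim): lottery ticket; floor = certified bounds/negative ranges. HONEST FRAMING: M1-LEAN-BLUEPRINT F6 (non-zero entries, master lemma;
blueprint «F6 DESIGN»): if the row pairings of two terms factor, `W_s p ⬝ᵥ G_t q = α p · β q`, with `α ∥ rep d`, `β ∥ rep e` both non-zero (over `𝔽₃`: `α = ±rep d`,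
`β = ±rep e`), then `Q s t = ∑_{p,q} Y q p (W_s p ⬝ᵥ G_t q)` equals `± PAIR(Y; d, e)` with `PAIR(Y; d, e) := ∑_{p,q} Y q p · rep d p · rep e q`
(`PairingFactor.Q_eq_pair_or_neg`); in particular `Q s t ≠ 0 ⟺ PAIR ≠ 0`, a fact about `X₀` and the two direction indices only. Plus the three factorisations
(R,R), (C,C), (C,R) of the blueprint as one-line lemmas and the rank-one factorisation of a non-zero singular `2 × 2` matrix over `𝔽₃` (decide). Nothing on `ω`.
-/

namespace Summit.MatrixMultiplication.OmegaCensus.SmallFormats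

open Finset Matrix

namespace PairingFactor

variable {n : ℕ}

/-- Over `𝔽₃`, a non-zero vector parallel to `rep d` is `± rep d`. -/
theorem eq_rep_or_neg (x : Fin 2 → ZMod 3) (d : Fin 4) (hx : x ≠ 0) (hpar : x 0 * (![![1, 0], ![0, 1], ![1, 1], ![1, 2]] : Fin 4 → Fin 2 → ZMod 3) d 1 - x 1 * (![![1, 0], ![0, 1], ![1, 1], ![1, 2]] : Fin 4 → Fin 2 → ZMod 3) d 0 = 0) :
    x = (![![1, 0], ![0, 1], ![1, 1], ![1, 2]] : Fin 4 → Fin 2 → ZMod 3) d ∨ x = -(![![1, 0], ![0, 1], ![1, 1], ![1, 2]] : Fin 4 → Fin 2 → ZMod 3) d := by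
  rcases (F3Lines.cross_rep_eq_zero_iff x d).mp hpar with h | h | h
  · exact absurd h hx
  · exact Or.inl h
  · exact Or.inr h

/-- **Master lemma.** Factored pairings with `±rep` directions give `Q = ± PAIR`. -/
theorem Q_eq_pair_or_neg (Y : Matrix (Fin 2) (Fin 2) (ZMod 3)) (W G : Matrix (Fin 2) (Fin n) (ZMod 3)) (α β : Fin 2 → ZMod 3)
    (hfac : ∀ p q, W p ⬝ᵥ G q = α p * β q) (d e : Fin 4) (hα : α = (![![1, 0], ![0, 1], ![1, 1], ![1, 2]] : Fin 4 → Fin 2 → ZMod 3) d ∨ α = -(![![1, 0], ![0, 1], ![1, 1], ![1, 2]] : Fin 4 → Fin 2 → ZMod 3) d) (hβ : β = (![![1, 0], ![0, 1], ![1, 1], ![1, 2]] : Fin 4 → Fin 2 → ZMod 3) e ∨ β = -(![![1, 0], ![0, 1], ![1, 1], ![1, 2]] : Fin 4 → Fin 2 → ZMod 3) e) :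
    (∑ p, ∑ q, Y q p * (W p ⬝ᵥ G q)) = ∑ p, ∑ q, Y q p * ((![![1, 0], ![0, 1], ![1, 1], ![1, 2]] : Fin 4 → Fin 2 → ZMod 3) d p * (![![1, 0], ![0, 1], ![1, 1], ![1, 2]] : Fin 4 → Fin 2 → ZMod 3) e q) ∨
    (∑ p, ∑ q, Y q p * (W p ⬝ᵥ G q)) = -∑ p, ∑ q, Y q p * ((![![1, 0], ![0, 1], ![1, 1], ![1, 2]] : Fin 4 → Fin 2 → ZMod 3) d p * (![![1, 0], ![0, 1], ![1, 1], ![1, 2]] : Fin 4 → Fin 2 → ZMod 3) e q) := by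
  -- the sign
  obtain ⟨σ, hσ, hαβ⟩ : ∃ σ : ZMod 3, (σ = 1 ∨ σ = -1) ∧ ∀ p q, α p * β q = σ * ((![![1, 0], ![0, 1], ![1, 1], ![1, 2]] : Fin 4 → Fin 2 → ZMod 3) d p * (![![1, 0], ![0, 1], ![1, 1], ![1, 2]] : Fin 4 → Fin 2 → ZMod 3) e q) := by
    rcases hα with rfl | rfl <;> rcases hβ with rfl | rfl
    · exact ⟨1, Or.inl rfl, fun p q => by ring⟩
    · exact ⟨-1, Or.inr rfl, fun p q => by simp only [Pi.neg_apply]; ring⟩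
    · exact ⟨-1, Or.inr rfl, fun p q => by simp only [Pi.neg_apply]; ring⟩
    · exact ⟨1, Or.inl rfl, fun p q => by simp only [Pi.neg_apply]; ring⟩
  have hQ : (∑ p, ∑ q, Y q p * (W p ⬝ᵥ G q)) = σ * ∑ p, ∑ q, Y q p * ((![![1, 0], ![0, 1], ![1, 1], ![1, 2]] : Fin 4 → Fin 2 → ZMod 3) d p * (![![1, 0], ![0, 1], ![1, 1], ![1, 2]] : Fin 4 → Fin 2 → ZMod 3) e q) := by
    rw [Finset.mul_sum]
    refine Finset.sum_congr rfl fun p _ => ?_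
    rw [Finset.mul_sum]
    refine Finset.sum_congr rfl fun q _ => ?_
    rw [hfac, hαβ]; ring
  rcases hσ with rfl | rfl
  · left; rw [hQ, one_mul]
  · right; rw [hQ, neg_one_mul]

/-- Hence such an entry is non-zero iff the point pairing is. -/
theorem Q_ne_zero_iff (Y : Matrix (Fin 2) (Fin 2) (ZMod 3)) (W G : Matrix (Fin 2) (Fin n) (ZMod 3)) (α β : Fin 2 → ZMod 3)
    (hfac : ∀ p q, W p ⬝ᵥ G q = α p * β q) (d e : Fin 4) (hα : α = (![![1, 0], ![0, 1], ![1, 1], ![1, 2]] : Fin 4 → Fin 2 → ZMod 3) d ∨ α = -(![![1, 0], ![0, 1], ![1, 1], ![1, 2]] : Fin 4 → Fin 2 → ZMod 3) d) (hβ : β = (![![1, 0], ![0, 1], ![1, 1], ![1, 2]] : Fin 4 → Fin 2 → ZMod 3) e ∨ β = -(![![1, 0], ![0, 1], ![1, 1], ![1, 2]] : Fin 4 → Fin 2 → ZMod 3) e) :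
    (∑ p, ∑ q, Y q p * (W p ⬝ᵥ G q)) ≠ 0 ↔ (∑ p, ∑ q, Y q p * ((![![1, 0], ![0, 1], ![1, 1], ![1, 2]] : Fin 4 → Fin 2 → ZMod 3) d p * (![![1, 0], ![0, 1], ![1, 1], ![1, 2]] : Fin 4 → Fin 2 → ZMod 3) e q)) ≠ 0 := by
  rcases Q_eq_pair_or_neg Y W G α β hfac d e hα hβ with h | h <;> rw [h]
  exact neg_ne_zero

/-- Factorisation (R-cell `s`): `W_s p = ω p • n⋆` ⇒ `W_s p ⬝ᵥ G q = ω p · (n⋆ ⬝ᵥ G q)`. -/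
theorem fac_of_W_line (W G : Matrix (Fin 2) (Fin n) (ZMod 3)) (nstar : Fin n → ZMod 3) (ω : Fin 2 → ZMod 3) (hW : ∀ p, W p = ω p • nstar)
    (p q : Fin 2) : W p ⬝ᵥ G q = ω p * (nstar ⬝ᵥ G q) := by
  rw [hW p, smul_dotProduct, smul_eq_mul]

/-- Factorisation (C-cell `t`): `G_t q = η q • c⋆` ⇒ `W p ⬝ᵥ G_t q = (W p ⬝ᵥ c⋆) · η q`. -/
theorem fac_of_G_line (W G : Matrix (Fin 2) (Fin n) (ZMod 3)) (cstar : Fin n → ZMod 3) (η : Fin 2 → ZMod 3) (hG : ∀ q, G q = η q • cstar)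
    (p q : Fin 2) : W p ⬝ᵥ G q = (W p ⬝ᵥ cstar) * η q := by
  rw [hG q, dotProduct_smul, smul_eq_mul, mul_comm]

/-- Factorisation (C-cell `s`, R-cell `t`) through a RANK-ONE Gram block `b l ⬝ᵥ c l' = lam l · kap l'`:
`W p ⬝ᵥ G q = (Ω λ)_p · (A κ)_q` for `W p = ∑ Ω p l • b l`, `G q = ∑ A q l' • c l'`. -/
theorem fac_of_block (W G : Matrix (Fin 2) (Fin n) (ZMod 3)) (b c : Fin 2 → (Fin n → ZMod 3)) (Ω A : Matrix (Fin 2) (Fin 2) (ZMod 3))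
    (hW : ∀ p, W p = ∑ l, Ω p l • b l) (hG : ∀ q, G q = ∑ l, A q l • c l) (lam kap : Fin 2 → ZMod 3)
    (hblock : ∀ l l', b l ⬝ᵥ c l' = lam l * kap l') (p q : Fin 2) :
    W p ⬝ᵥ G q = (Matrix.mulVec Ω lam) p * (Matrix.mulVec A kap) q := by
  rw [hW p, hG q, sum_dotProduct]
  simp_rw [dotProduct_sum, smul_dotProduct, dotProduct_smul, smul_eq_mul, hblock]
  rw [Matrix.mulVec, Matrix.mulVec, dotProduct, dotProduct, Finset.sum_mul_sum]
  exact Finset.sum_congr rfl fun l _ => Finset.sum_congr rfl fun l' _ => by ring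

/-- Over `𝔽₃` a non-zero singular `2 × 2` matrix is an outer product of two non-zero vectors. -/
theorem exists_outer_of_det_eq_zero (P : Matrix (Fin 2) (Fin 2) (ZMod 3)) (hP : P ≠ 0) (hdet : P.det = 0) :
    ∃ lam kap : Fin 2 → ZMod 3, lam ≠ 0 ∧ kap ≠ 0 ∧ ∀ l l', P l l' = lam l * kap l' := by
  revert P
  decide

end PairingFactor

end Summit.MatrixMultiplication.OmegaCensus.SmallFormats
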